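import Literature.Analysis.FunctionSpaces.TorusPlateauCutoff
import Literature.Analysis.FunctionSpaces.TorusLiftDerivBounds
import HarnessLib

/-!
# Nested plateau cut-offs around a set and their products over lacunary dilations
# (the cut-offs `χ_k` of Coiculescu–Palasek, Def. 3.4, made precise)

Analysis/FunctionSpaces support file (definitions with proved API; no named facts). M. P. Coiculescu,
S. Palasek, Invent. Math. 244 (2025), arXiv:2503.14699, **Def. 3.4** ask for "a cutoff function `χ_k`
which is identically `1` in `Ω_{k-1}`, identically `0` outside of `Ω̃_{k-1}`, and obeys
`‖∇^mχ_k‖_{L^∞} ≲_m M_{k-1}^m`", where (Def. 3.1) `Ω_k = ⋂_{m ≤ k} ⋃_j Ω_{j,m}`, `Ω̃_k = ⋂_{m≤k} ⋃_j Ω̃_{j,m}` are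
intersections over all coarser scales of the `δ₀`- and `2δ₀`-neighbourhoods of the pipes of scale `m`,
and Rmk. 3.12 / §5 use that "`χ_{k+1}` is identically equal to `1` on `supp 𝒟ψ⁰_k`". Since
`supp ψ⁰_k ⊆ (ℓ_k`-neighbourhood of`) supp χ_k ∩ (pipes of scale k)` and `χ_k` is a FACTOR of the
amplitudes (so `supp χ_k`, not `Ω_{k-1}`, is what must be covered), a family with these properties is
obtained from NESTED plateaux whose radii at each fixed scale grow (summably) with the level:

* `Torus.plateauRadius δ₀ i = δ₀(2 - 2⁻ⁱ)`, `Torus.plateauScale δ₀ i = δ₀/(10·2ⁱ)` (`r_{i+1} = r_i + 5δ_i`);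
* `Torus.setPlateau P δ₀ i` — a smooth `[0,1]`-valued cut-off, `= 1` on the `δ_i`-neighbourhood of
  `thickening r_i P`, `= 0` off `thickening r_{i+1} P`, with `‖Dⁿ‖ ≤ c̄_n δ_i⁻ⁿ` (from
  `Torus.exists_plateau_cutoff`); consecutive plateaux are nested WITH MARGIN:
  `setPlateau i y ≠ 0 ∧ dist x y < δ_{i+1} → setPlateau (i+1) x = 1` (`setPlateau_succ_eq_one_of_dist_lt`);
* `Torus.nestedCutoff P δ₀ M k x = ∏_{m<k} setPlateau P δ₀ (k-m) (M_m • x)` — the cut-off at level `k` for a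
  sequence of integer dilations `M_m` (for Coiculescu–Palasek: `χ_k`, `P = ⋃_j supp φ̃_j`);
* `Torus.nestedCutoff_succ_eq_one_of_dist_lt` — **the covering property**: if `nestedCutoff k y ≠ 0`,
  `M_k • y ∈ P` and `dist x y < ε` with `M_m ε ≤ δ_{k+1-m}` for all `m ≤ k`, then `nestedCutoff (k+1) x = 1`
  (so `χ_{k+1} ≡ 1` on the `ε`-neighbourhood of `supp χ_k ∩ (M_k•)⁻¹P`, which contains `supp 𝒟ψ⁰_k`);
* `Torus.mem_thickening_of_nestedCutoff_ne_zero` — **supports**: `nestedCutoff k x ≠ 0` forces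
  `M_m • x ∈ thickening (2δ₀) P` for every `m < k` (intermittency: the support lies in the
  intersection over all coarser scales of the fat pipes);
* `Torus.hasLiftDerivBounds_nestedCutoff` — **`‖∇ⁿχ_k‖ ≲_n (∑_{m<k} 2^{k-m} M_m/δ₀)ⁿ`** in the currency
  `HasLiftDerivBounds n (nestedCutoff k) 1 (10 c̄_n δ₀⁻¹ ∑_{m<k} 2^{k-m} M_m)` — the power-form
  multi-factor Leibniz bound `norm_iteratedFDeriv_finset_prod_le_pow` with the dilation rule; for
  lacunary `M_m` (`4M_m ≤ M_{m+1}`) the sum is `≤ 4M_{k-1}` (`sum_pow_mul_le_of_lacunary`), giving the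
  printed `≲_n M_{k-1}ⁿ`.

## Mathlib / tree search

Tree: `Torus.exists_plateau_cutoff`, `norm_iteratedFDeriv_finset_prod_le_pow` (`TorusPlateauCutoff`),
`Torus.HasLiftDerivBounds` with `comp_nsmul`, `derivProfileMassSup` (`TorusLiftDerivBounds`). Mathlib:
`Metric.thickening`, `thickening_thickening_subset`, `norm_nsmul_le`. `lean search 'nestedCutoff|plateau '`: (`Torus.plateau` of `TorusCompactSupportZeroMean` is an unrelated
1-d profile, whence the name `setPlateau` here);
nothing prior.

## References

* M. P. Coiculescu, S. Palasek, Invent. Math. 244 (2025) 165–219, arXiv:2503.14699: Def. 3.1 (the regions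
  `Ω_k`, `Ω̃_k`), Def. 3.4 (the cut-offs `χ_k`), Rmk. 3.12 and §5 ("`χ_{k+1}` is identically equal to `1` on
  `supp 𝒟ψ⁰_k`"), Lemma 3.3 (supports). [CoiculescuPalasek2025]
* L. C. Evans, *Partial Differential Equations*, 2nd ed., AMS 2010, App. C.4 (cut-offs by mollification).
  [Evans2010]
-/

noncomputable section

open Set Metric Function MeasureTheory Filter
open scoped BigOperators ContDiff Convolution Topology

namespace Literature.Analysis.FunctionSpaces

namespace Torus

variable {d : Type*} [Fintype d] [DecidableEq d]

/-! ## Radii and scales of the plateaux -/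

/-- The radius of the `i`-th plateau: `r_i = δ₀ (2 - 2⁻ⁱ)` (`r_0 = δ₀`, increasing to `2δ₀`). [folklore] -/
def plateauRadius (δ₀ : ℝ) (i : ℕ) : ℝ := δ₀ * (2 - ((2 : ℝ) ^ i)⁻¹)

/-- The scale of the `i`-th plateau: `δ_i = δ₀/(10·2ⁱ)`, one fifth of the gap `r_{i+1} - r_i = δ₀ 2^{-(i+1)}`. [folklore] -/
def plateauScale (δ₀ : ℝ) (i : ℕ) : ℝ := δ₀ / (10 * (2 : ℝ) ^ i)

section Radii

variable {δ₀ : ℝ}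

/-- `r_{i+1} = r_i + 5 δ_i`. [folklore] -/
theorem plateauRadius_succ (δ₀ : ℝ) (i : ℕ) :
    plateauRadius δ₀ (i + 1) = plateauRadius δ₀ i + 5 * plateauScale δ₀ i := by
  unfold plateauRadius plateauScale
  have h2 : (2 : ℝ) ^ i ≠ 0 := pow_ne_zero _ two_ne_zero
  rw [pow_succ]
  field_simp
  ring

/-- `0 < δ_i` for `δ₀ > 0`. [folklore] -/
theorem plateauScale_pos (hδ₀ : 0 < δ₀) (i : ℕ) : 0 < plateauScale δ₀ i := by
  unfold plateauScale; positivity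

/-- `δ_i ≤ δ₀/10 ≤ 1/4` for `δ₀ ≤ 1`. [folklore] -/
theorem plateauScale_le (hδ₀' : δ₀ ≤ 1) (i : ℕ) : plateauScale δ₀ i ≤ 1 / 4 := by
  unfold plateauScale
  have h2 : (1 : ℝ) ≤ (2 : ℝ) ^ i := one_le_pow₀ (by norm_num)
  rw [div_le_iff₀ (by positivity)]
  nlinarith

/-- `δ_{i+1} ≤ δ_i` (the scales decrease). [folklore] -/
theorem plateauScale_succ_le (hδ₀ : 0 < δ₀) (i : ℕ) : plateauScale δ₀ (i + 1) ≤ plateauScale δ₀ i := by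
  unfold plateauScale
  rw [pow_succ]
  have h2 : (0 : ℝ) < (2 : ℝ) ^ i := pow_pos two_pos i
  exact div_le_div_of_nonneg_left hδ₀.le (by positivity) (by nlinarith)

/-- `δ_i` is antitone in `i`. [folklore] -/
theorem plateauScale_antitone (hδ₀ : 0 < δ₀) : Antitone (plateauScale δ₀) :=
  antitone_nat_of_succ_le fun i => plateauScale_succ_le hδ₀ i

/-- `δ₀ ≤ r_i`. [folklore] -/
theorem le_plateauRadius (hδ₀ : 0 ≤ δ₀) (i : ℕ) : δ₀ ≤ plateauRadius δ₀ i := by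
  unfold plateauRadius
  have h2 : (1 : ℝ) ≤ (2 : ℝ) ^ i := one_le_pow₀ (by norm_num)
  have h3 : ((2 : ℝ) ^ i)⁻¹ ≤ 1 := inv_le_one_of_one_le₀ h2
  nlinarith

/-- `r_i ≤ 2δ₀`. [folklore] -/
theorem plateauRadius_le (hδ₀ : 0 ≤ δ₀) (i : ℕ) : plateauRadius δ₀ i ≤ 2 * δ₀ := by
  unfold plateauRadius
  have h3 : 0 ≤ ((2 : ℝ) ^ i)⁻¹ := by positivity
  nlinarith

/-- `r_i ≤ r_{i+1}`. [folklore] -/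
theorem plateauRadius_le_succ (hδ₀ : 0 < δ₀) (i : ℕ) : plateauRadius δ₀ i ≤ plateauRadius δ₀ (i + 1) := by
  rw [plateauRadius_succ]
  have := plateauScale_pos hδ₀ i
  linarith

/-- `δ_i ≤ r_0 = δ₀` (indeed `δ_i ≤ δ₀/10`). [folklore] -/
theorem plateauScale_le_self (hδ₀ : 0 ≤ δ₀) (i : ℕ) : plateauScale δ₀ i ≤ δ₀ := by
  unfold plateauScale
  have h2 : (1 : ℝ) ≤ (2 : ℝ) ^ i := one_le_pow₀ (by norm_num)
  rw [div_le_iff₀ (by positivity)]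
  nlinarith

end Radii

/-! ## The plateaux -/

/-- **The `i`-th plateau cut-off around `P`**: a smooth `[0,1]`-valued function on `T^d`, `= 1` on the
`δ_i`-neighbourhood of `thickening r_i P` and `= 0` off its `5δ_i`-neighbourhood, with all derivatives
bounded by `c_n δ_i⁻ⁿ` (`Torus.exists_plateau_cutoff`; the junk value `0` when `δ₀ ∉ (0,1]`).
[cite: Evans2010, App. C.4 Thm. 7] -/
def setPlateau (P : Set (UnitAddTorus d)) (δ₀ : ℝ) (i : ℕ) : UnitAddTorus d → ℝ :=
  if h : 0 < δ₀ ∧ δ₀ ≤ 1 then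
    Classical.choose (exists_plateau_cutoff (thickening (plateauRadius δ₀ i) P)
      (plateauScale_pos h.1 i) (plateauScale_le h.2 i))
  else fun _ => 0

section Plateau

variable {P : Set (UnitAddTorus d)} {δ₀ : ℝ} (hδ₀ : 0 < δ₀) (hδ₀' : δ₀ ≤ 1)
include hδ₀ hδ₀'

/-- The defining properties of the plateau `setPlateau`. [cite: Evans2010, App. C.4 Thm. 7] -/
theorem setPlateau_spec (i : ℕ) :
    IsSmooth (setPlateau P δ₀ i) ∧ (∀ x, 0 ≤ setPlateau P δ₀ i x ∧ setPlateau P δ₀ i x ≤ 1) ∧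
      (∀ x ∈ thickening (plateauScale δ₀ i) (thickening (plateauRadius δ₀ i) P), setPlateau P δ₀ i x = 1) ∧
      (∀ x ∉ thickening (5 * plateauScale δ₀ i) (thickening (plateauRadius δ₀ i) P), setPlateau P δ₀ i x = 0) ∧
      ∀ (n : ℕ) (y : EuclideanSpace ℝ d),
        ‖iteratedFDeriv ℝ n (lift (setPlateau P δ₀ i)) y‖ ≤ derivProfileMass d n * (plateauScale δ₀ i ^ n)⁻¹ := by
  have h : 0 < δ₀ ∧ δ₀ ≤ 1 := ⟨hδ₀, hδ₀'⟩
  simp only [setPlateau, dif_pos h]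
  exact Classical.choose_spec (exists_plateau_cutoff (thickening (plateauRadius δ₀ i) P)
    (plateauScale_pos h.1 i) (plateauScale_le h.2 i))

/-- The plateau is smooth. [folklore] -/
theorem isSmooth_setPlateau (i : ℕ) : IsSmooth (setPlateau P δ₀ i) := (setPlateau_spec hδ₀ hδ₀' i).1

/-- The plateau takes values in `[0,1]`. [folklore] -/
theorem setPlateau_mem_Icc (i : ℕ) (x : UnitAddTorus d) : 0 ≤ setPlateau P δ₀ i x ∧ setPlateau P δ₀ i x ≤ 1 :=
  (setPlateau_spec hδ₀ hδ₀' i).2.1 x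

/-- `‖setPlateau P δ₀ i x‖ ≤ 1`. [folklore] -/
theorem norm_setPlateau_le (i : ℕ) (x : UnitAddTorus d) : ‖setPlateau P δ₀ i x‖ ≤ 1 := by
  have h := setPlateau_mem_Icc hδ₀ hδ₀' (P := P) i x
  rw [Real.norm_eq_abs, abs_le]
  exact ⟨by linarith [h.1], h.2⟩

/-- **`setPlateau i = 1` on `thickening r_i P`** (in particular on the `δ₀`-neighbourhood of `P`). [folklore] -/
theorem setPlateau_eq_one_of_mem (i : ℕ) {x : UnitAddTorus d} (hx : x ∈ thickening (plateauRadius δ₀ i) P) :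
    setPlateau P δ₀ i x = 1 :=
  (setPlateau_spec hδ₀ hδ₀' i).2.2.1 x (mem_thickening_iff.2 ⟨x, hx, by rw [dist_self]; exact plateauScale_pos hδ₀ i⟩)

/-- `setPlateau i = 1` on the `δ₀`-neighbourhood of `P`. [folklore] -/
theorem setPlateau_eq_one_of_mem_thickening (i : ℕ) {x : UnitAddTorus d} (hx : x ∈ thickening δ₀ P) :
    setPlateau P δ₀ i x = 1 :=
  setPlateau_eq_one_of_mem hδ₀ hδ₀' i (thickening_mono (le_plateauRadius hδ₀.le i) P hx)

/-- **Supports: `setPlateau i x ≠ 0` forces `x ∈ thickening r_{i+1} P`** (`⊆ thickening (2δ₀) P`). [folklore] -/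
theorem mem_thickening_of_setPlateau_ne_zero (i : ℕ) {x : UnitAddTorus d} (hx : setPlateau P δ₀ i x ≠ 0) :
    x ∈ thickening (plateauRadius δ₀ (i + 1)) P := by
  by_contra hnot
  refine hx ((setPlateau_spec hδ₀ hδ₀' i).2.2.2.1 x fun hmem => hnot ?_)
  have h := thickening_thickening_subset (5 * plateauScale δ₀ i) (plateauRadius δ₀ i) P hmem
  rwa [add_comm, ← plateauRadius_succ] at h

/-- `setPlateau i x ≠ 0` forces `x ∈ thickening (2δ₀) P`. [folklore] -/
theorem mem_thickening_two_mul_of_setPlateau_ne_zero (i : ℕ) {x : UnitAddTorus d} (hx : setPlateau P δ₀ i x ≠ 0) :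
    x ∈ thickening (2 * δ₀) P :=
  thickening_mono (plateauRadius_le hδ₀.le (i + 1)) P (mem_thickening_of_setPlateau_ne_zero hδ₀ hδ₀' i hx)

/-- **Nestedness with margin**: if `setPlateau i y ≠ 0` and `dist x y < δ_{i+1}` then `setPlateau (i+1) x = 1`.
[folklore] -/
theorem setPlateau_succ_eq_one_of_dist_lt (i : ℕ) {x y : UnitAddTorus d} (hy : setPlateau P δ₀ i y ≠ 0)
    (hxy : dist x y < plateauScale δ₀ (i + 1)) : setPlateau P δ₀ (i + 1) x = 1 :=
  (setPlateau_spec hδ₀ hδ₀' (i + 1)).2.2.1 x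
    (mem_thickening_iff.2 ⟨y, mem_thickening_of_setPlateau_ne_zero hδ₀ hδ₀' i hy, hxy⟩)

/-- **All derivatives of the setPlateau**: `HasLiftDerivBounds n (setPlateau i) 1 (c̄_n/δ_i)`. [cite: Evans2010, App. C.4 Thm. 7] -/
theorem hasLiftDerivBounds_setPlateau (n i : ℕ) :
    HasLiftDerivBounds n (setPlateau P δ₀ i) 1 (derivProfileMassSup d n / plateauScale δ₀ i) := by
  have hδ := plateauScale_pos hδ₀ (δ₀ := δ₀) i
  refine ⟨isSmooth_setPlateau hδ₀ hδ₀' i, fun m hm y => ((setPlateau_spec hδ₀ hδ₀' i).2.2.2.2 m y).trans ?_⟩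
  rw [one_mul, div_pow, div_eq_mul_inv]
  refine mul_le_mul_of_nonneg_right ?_ (by positivity)
  rcases Nat.eq_zero_or_pos m with rfl | hpos
  · rw [derivProfileMass_zero, pow_zero]
  · calc derivProfileMass d m ≤ derivProfileMassSup d n := derivProfileMass_le_sup hm
      _ = derivProfileMassSup d n ^ 1 := (pow_one _).symm
      _ ≤ derivProfileMassSup d n ^ m := pow_le_pow_right₀ (one_le_derivProfileMassSup n) hpos

end Plateau

/-! ## Products over dilations: the cut-offs `χ_k` -/

/-- **The nested cut-off at level `k`** for a sequence of integer dilations `M_m`: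
`χ_k(x) = ∏_{m<k} setPlateau P δ₀ (k-m) (M_m • x)` (the factor living at scale `m` uses the setPlateau of
index `k - m ≥ 1`, which grows with the level). For Coiculescu–Palasek, `P = ⋃_j supp φ̃_j` and these
are the `χ_k` of Def. 3.4 (`χ_0 ≡ 1`, unused). [cite: CoiculescuPalasek2025, Def. 3.4] -/
def nestedCutoff (P : Set (UnitAddTorus d)) (δ₀ : ℝ) (M : ℕ → ℕ) (k : ℕ) (x : UnitAddTorus d) : ℝ :=
  ∏ m ∈ Finset.range k, setPlateau P δ₀ (k - m) (M m • x)

section Nested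

variable {P : Set (UnitAddTorus d)} {δ₀ : ℝ} {M : ℕ → ℕ} (hδ₀ : 0 < δ₀) (hδ₀' : δ₀ ≤ 1)
include hδ₀ hδ₀'

omit hδ₀ hδ₀' in
/-- Unfolding. [folklore] -/
theorem nestedCutoff_apply (P : Set (UnitAddTorus d)) (δ₀ : ℝ) (M : ℕ → ℕ) (k : ℕ) (x : UnitAddTorus d) :
    nestedCutoff P δ₀ M k x = ∏ m ∈ Finset.range k, setPlateau P δ₀ (k - m) (M m • x) := rfl

omit hδ₀ hδ₀' in
/-- `χ_0 ≡ 1`. [folklore] -/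
theorem nestedCutoff_zero (P : Set (UnitAddTorus d)) (δ₀ : ℝ) (M : ℕ → ℕ) (x : UnitAddTorus d) :
    nestedCutoff P δ₀ M 0 x = 1 := by
  simp [nestedCutoff]

/-- `χ_k` takes values in `[0,1]`. [cite: CoiculescuPalasek2025, Def. 3.4] -/
theorem nestedCutoff_mem_Icc (k : ℕ) (x : UnitAddTorus d) :
    0 ≤ nestedCutoff P δ₀ M k x ∧ nestedCutoff P δ₀ M k x ≤ 1 := by
  refine ⟨Finset.prod_nonneg fun m _ => (setPlateau_mem_Icc hδ₀ hδ₀' _ _).1, ?_⟩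
  exact Finset.prod_le_one (fun m _ => (setPlateau_mem_Icc hδ₀ hδ₀' _ _).1) fun m _ => (setPlateau_mem_Icc hδ₀ hδ₀' _ _).2

/-- `‖χ_k‖ ≤ 1`. [cite: CoiculescuPalasek2025, Def. 3.4] -/
theorem norm_nestedCutoff_le (k : ℕ) (x : UnitAddTorus d) : ‖nestedCutoff P δ₀ M k x‖ ≤ 1 := by
  have h := nestedCutoff_mem_Icc hδ₀ hδ₀' (P := P) (M := M) k x
  rw [Real.norm_eq_abs, abs_le]
  exact ⟨by linarith [h.1], h.2⟩

omit [DecidableEq d] hδ₀ hδ₀' in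
/-- Integer dilations of the torus are Lipschitz: `dist (M • x) (M • y) ≤ M dist x y`. [folklore] -/
theorem dist_nsmul_nsmul_le (M : ℕ) (x y : UnitAddTorus d) : dist (M • x) (M • y) ≤ M * dist x y := by
  rw [dist_eq_norm, dist_eq_norm, ← nsmul_sub]
  exact norm_nsmul_le

/-- **The covering property** (what "`χ_{k+1}` is identically `1` on `supp 𝒟ψ⁰_k`" needs): if
`χ_k y ≠ 0`, `M_k • y ∈ P`, and `x` is `ε`-close to `y` with `M_m ε ≤ δ_{k+1-m}` for every `m ≤ k`, then
`χ_{k+1} x = 1`. [cite: CoiculescuPalasek2025, Rmk. 3.12 and §5 with Def. 3.4] -/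
theorem nestedCutoff_succ_eq_one_of_dist_lt (k : ℕ) {x y : UnitAddTorus d} {ε : ℝ}
    (hy : nestedCutoff P δ₀ M k y ≠ 0) (hyP : M k • y ∈ P)
    (hε : ∀ m ≤ k, (M m : ℝ) * ε ≤ plateauScale δ₀ (k + 1 - m)) (hxy : dist x y < ε) :
    nestedCutoff P δ₀ M (k + 1) x = 1 := by
  rw [nestedCutoff_apply]
  refine Finset.prod_eq_one fun m hm => ?_
  have hmk : m < k + 1 := Finset.mem_range.1 hm
  have hdist : dist (M m • x) (M m • y) < plateauScale δ₀ (k + 1 - m) := by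
    refine (dist_nsmul_nsmul_le (M m) x y).trans_lt ?_
    rcases Nat.eq_zero_or_pos (M m) with h0 | hpos
    · rw [h0, Nat.cast_zero, zero_mul]; exact plateauScale_pos hδ₀ _
    · exact (mul_lt_mul_of_pos_left hxy (by exact_mod_cast hpos)).trans_le (hε m (by omega))
  rcases Nat.lt_or_ge m k with hlt | hge
  · -- an old factor: `setPlateau (k-m) (M_m • y) ≠ 0` and the margin give `setPlateau (k+1-m) (M_m • x) = 1`
    have hfac : setPlateau P δ₀ (k - m) (M m • y) ≠ 0 := by
      intro h0
      apply hy
      rw [nestedCutoff_apply]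
      exact Finset.prod_eq_zero (Finset.mem_range.2 hlt) h0
    have h := setPlateau_succ_eq_one_of_dist_lt hδ₀ hδ₀' (P := P) (k - m) hfac (by rwa [show k - m + 1 = k + 1 - m by omega])
    rwa [show k - m + 1 = k + 1 - m by omega] at h
  · -- the new factor `m = k`: `M_k • y ∈ P` and `dist < δ_1 ≤ δ₀`
    have hmk' : m = k := by omega
    subst hmk'
    refine setPlateau_eq_one_of_mem_thickening hδ₀ hδ₀' _ (mem_thickening_iff.2 ⟨M m • y, hyP, ?_⟩)
    exact hdist.trans_le (by rw [show m + 1 - m = 1 by omega]; exact plateauScale_le_self hδ₀.le 1)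

/-- **Supports of `χ_k`**: `χ_k x ≠ 0` forces `M_m • x ∈ thickening (2δ₀) P` for every `m < k` (the support
lies in the intersection over all coarser scales of the fat pipes: `supp χ_k ⊆ Ω̃`-type inclusion).
[cite: CoiculescuPalasek2025, Def. 3.4 with Def. 3.1 and Lemma 3.3] -/
theorem mem_thickening_of_nestedCutoff_ne_zero (k : ℕ) {x : UnitAddTorus d} (hx : nestedCutoff P δ₀ M k x ≠ 0)
    {m : ℕ} (hm : m < k) : M m • x ∈ thickening (2 * δ₀) P := by
  refine mem_thickening_two_mul_of_setPlateau_ne_zero hδ₀ hδ₀' (k - m) fun h0 => hx ?_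
  rw [nestedCutoff_apply]
  exact Finset.prod_eq_zero (Finset.mem_range.2 hm) h0

/-- **All derivatives of `χ_k`** (the power-form multi-factor Leibniz bound over the dilated plateaux):
`HasLiftDerivBounds n χ_k 1 (∑_{m<k} c̄_n M_m / δ_{k-m})`, i.e. `‖Dⁱχ_k‖ ≤ (10 c̄_n δ₀⁻¹ ∑_{m<k} 2^{k-m} M_m)ⁱ`.
[cite: CoiculescuPalasek2025, Def. 3.4 (`‖∇^mχ_k‖_{L^∞} ≲_m M_{k-1}^m`)] -/
theorem hasLiftDerivBounds_nestedCutoff (n k : ℕ) :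
    HasLiftDerivBounds n (nestedCutoff P δ₀ M k) 1
      (∑ m ∈ Finset.range k, (M m : ℝ) * (derivProfileMassSup d n / plateauScale δ₀ (k - m))) := by
  -- each dilated factor
  have hfac : ∀ m ∈ Finset.range k, HasLiftDerivBounds n (fun x => setPlateau P δ₀ (k - m) (M m • x)) 1
      ((M m : ℝ) * (derivProfileMassSup d n / plateauScale δ₀ (k - m))) :=
    fun m _ => (hasLiftDerivBounds_setPlateau hδ₀ hδ₀' n (k - m)).comp_nsmul (M m)
  have hsm : IsSmooth (nestedCutoff P δ₀ M k) := by
    show ContDiff ℝ ∞ (lift fun x => ∏ m ∈ Finset.range k, setPlateau P δ₀ (k - m) (M m • x))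
    have : lift (fun x => ∏ m ∈ Finset.range k, setPlateau P δ₀ (k - m) (M m • x)) =
        fun y => ∏ m ∈ Finset.range k, lift (fun x => setPlateau P δ₀ (k - m) (M m • x)) y := by
      funext y; simp [lift_apply]
    rw [this]
    exact contDiff_prod fun m hm => (hfac m hm).isSmooth
  refine ⟨hsm, fun i hi y => ?_⟩
  have hlift : lift (nestedCutoff P δ₀ M k) =
      fun y => ∏ m ∈ Finset.range k, lift (fun x => setPlateau P δ₀ (k - m) (M m • x)) y := by
    funext y; simp [lift_apply, nestedCutoff]
  rw [hlift, one_mul]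
  refine norm_iteratedFDeriv_finset_prod_le_pow (Finset.range k)
    (f := fun m => lift (fun x => setPlateau P δ₀ (k - m) (M m • x)))
    (L := fun m => (M m : ℝ) * (derivProfileMassSup d n / plateauScale δ₀ (k - m)))
    (fun m hm => (hfac m hm).contDiff) (fun m hm z => ?_) (fun m hm => ?_) (fun m hm a ha1 han z => ?_) i hi y
  · rw [lift_apply]; exact norm_setPlateau_le hδ₀ hδ₀' _ _
  · have := plateauScale_pos hδ₀ (δ₀ := δ₀) (k - m); have := one_le_derivProfileMassSup (d := d) n
    positivity
  · simpa using (hfac m hm).bound han z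

omit hδ₀' in
/-- **The lacunary sum**: if `4 M_m ≤ M_{m+1}` for all `m`, then
`∑_{m<k} M_m/δ_{k-m} ≤ 40 M_{k-1}/δ₀` for `k ≥ 1` (`2^{k-m} M_m ≤ 2 M_{k-1} 2^{-(k-1-m)}`), whence
`‖∇ⁱχ_k‖ ≤ (40 c̄_n M_{k-1}/δ₀)ⁱ` — the printed `≲_m M_{k-1}^m`. [cite: CoiculescuPalasek2025, Def. 3.4] -/
theorem sum_mul_div_plateauScale_le (hM : ∀ m, 4 * M m ≤ M (m + 1)) (k : ℕ) :
    ∑ m ∈ Finset.range (k + 1), (M m : ℝ) * (plateauScale δ₀ (k + 1 - m))⁻¹ ≤ 40 * M k / δ₀ := by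
  -- `(δ_{k+1-m})⁻¹ = 10 · 2^{k+1-m} / δ₀` and `2^{k+1-m} M_m ≤ 2 M_k / 2^{k-m}`
  have hinv : ∀ m ∈ Finset.range (k + 1), (M m : ℝ) * (plateauScale δ₀ (k + 1 - m))⁻¹ =
      (10 / δ₀) * ((2 : ℝ) ^ (k + 1 - m) * M m) := by
    intro m _
    unfold plateauScale
    field_simp
  rw [Finset.sum_congr rfl hinv, ← Finset.mul_sum]
  -- the lacunary bound `∑_{m ≤ k} 2^{k+1-m} M_m ≤ 4 M_k`
  have hlac : ∀ k, ∑ m ∈ Finset.range (k + 1), (2 : ℝ) ^ (k + 1 - m) * M m ≤ 4 * M k := by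
    intro k
    induction k with
    | zero => simp; linarith [(Nat.cast_nonneg (M 0) : (0:ℝ) ≤ M 0)]
    | succ k ih =>
      rw [Finset.sum_range_succ, show k + 1 + 1 - (k + 1) = 1 by omega, pow_one]
      have hstep : ∑ m ∈ Finset.range (k + 1), (2 : ℝ) ^ (k + 1 + 1 - m) * M m =
          2 * ∑ m ∈ Finset.range (k + 1), (2 : ℝ) ^ (k + 1 - m) * M m := by
        rw [Finset.mul_sum]
        refine Finset.sum_congr rfl fun m hm => ?_
        have hmk : m < k + 1 := Finset.mem_range.1 hm
        rw [show k + 1 + 1 - m = (k + 1 - m) + 1 by omega, pow_succ]; ring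
      rw [hstep]
      have h4 : (4 : ℝ) * M k ≤ M (k + 1) := by exact_mod_cast hM k
      linarith [ih]
  have h := hlac k
  have hδ : 0 < 10 / δ₀ := by positivity
  calc 10 / δ₀ * ∑ m ∈ Finset.range (k + 1), (2 : ℝ) ^ (k + 1 - m) * M m ≤ 10 / δ₀ * (4 * M k) :=
        mul_le_mul_of_nonneg_left h hδ.le
    _ = 40 * M k / δ₀ := by ring

/-- **`χ_{k+1}` in the currency with the printed frequency**: under `4M_m ≤ M_{m+1}`,
`HasLiftDerivBounds n χ_{k+1} 1 (40 c̄_n M_k / δ₀)`. [cite: CoiculescuPalasek2025, Def. 3.4] -/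
theorem hasLiftDerivBounds_nestedCutoff_succ (hM : ∀ m, 4 * M m ≤ M (m + 1)) (n k : ℕ) :
    HasLiftDerivBounds n (nestedCutoff P δ₀ M (k + 1)) 1 (40 * derivProfileMassSup d n * M k / δ₀) := by
  have h := hasLiftDerivBounds_nestedCutoff hδ₀ hδ₀' (P := P) (M := M) n (k + 1)
  refine h.mono le_rfl (Finset.sum_nonneg fun m _ => ?_) ?_
  · have := plateauScale_pos hδ₀ (δ₀ := δ₀) (k + 1 - m); have := one_le_derivProfileMassSup (d := d) n
    positivity
  · have hs := sum_mul_div_plateauScale_le hδ₀ (M := M) hM k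
    have hc : 0 ≤ derivProfileMassSup d n := zero_le_one.trans (one_le_derivProfileMassSup n)
    calc ∑ m ∈ Finset.range (k + 1), (M m : ℝ) * (derivProfileMassSup d n / plateauScale δ₀ (k + 1 - m))
        = derivProfileMassSup d n * ∑ m ∈ Finset.range (k + 1), (M m : ℝ) * (plateauScale δ₀ (k + 1 - m))⁻¹ := by
          rw [Finset.mul_sum]
          exact Finset.sum_congr rfl fun m _ => by ring
      _ ≤ derivProfileMassSup d n * (40 * M k / δ₀) := mul_le_mul_of_nonneg_left hs hc
      _ = 40 * derivProfileMassSup d n * M k / δ₀ := by ring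

end Nested

end Torus

end Literature.Analysis.FunctionSpaces
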